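import Mathlib
import Literature.Computability.AlgebraicComplexity.LinSubst
import Literature.Computability.AlgebraicComplexity.OrbitClosure
import Literature.Computability.AlgebraicComplexity.StandardFamilies
import Summits.ValiantsHypothesis.ValiantsHypothesis.Theorems.BorderApolarityToricWitnessObstructionQPStubPencilOfNormalForm
import Summits.ValiantsHypothesis.ValiantsHypothesis.Theorems.BorderApolarityToricWitnessObstructionQPJetRegime
import Summits.ValiantsHypothesis.ValiantsHypothesis.Theorems.BorderApolarityToricWitnessObstructionQPWeightedSubst

/-!
# Bridge: x₀₀-dominant extremal toric representations of the padded `per₃` have size `≥ 7`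

Route `ValiantsHypothesis/BorderApolarity`, crux `ToricWitnessObstructionQP`
(stmt-ValiantsHypothesis-14753), line `Sketch`, lead c5 — the jet-regime theorem
`jetRegime_seven_le` transported to the objects of the line's landed normal-form chain
(crux work note `RegimesPer3BelowGrenet.md` §3): extremal toric representations
`X₀₀^{m-3} per₃ = in^w_e (g · det_m)` (the shape produced by `stub_socleMax`/`stub_normalForm` and
consumed by `stub_pencilOfNormalForm`).

* `seven_le_of_extremalToricRep_dominant`: if `F := g · det_m` (any matrix `g`, `m ≥ 3`) has all
  `w`-weights `≤ e`, `paddedPerPoly ℂ 3 m = in^w_e F`, and the cocharacter is x₀₀-DOMINANT in the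
  sense `wmin ≤ w` on the block, `wmin ≤ w(0,0)` and `e < (m-2)·w(0,0) + 2·wmin`, then `7 ≤ m`.

Proof: specialise `F` in two weight-compatible steps (`WeightedSubst`): unused variables `↦ 0`,
block `↦ y`, `x₀₀ ↦ T` gives a form `Q` in ten variables with the same degree `m` and the same
weights; `T ↦ 1` gives `P = det A'` for an affine `m × m` matrix `A'` over the nine variables.
Dominance and `weights ≤ e` kill the parts of `Q` of block-degree `≤ 2`, i.e. `P₀ = P₁ = P₂ = 0`; the
block-degree-`3` part of the weight-`e` component of `Q` is `T^{m-3}·per₃`, whence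
`in^γ_{e₃} P₃ = per₃` with `e₃ = e - (m-3)·w(0,0)`; then `jetRegime_seven_le`.
-/

open MvPolynomial Module

-- the mandated summit-side namespace repeats a component by design (single-problem summit)
set_option linter.dupNamespace false

namespace Summit.ValiantsHypothesis.ValiantsHypothesis.Theorems.BorderApolarityToricWitnessObstructionQP

noncomputable section

namespace Bridge

open Literature.Computability.AlgebraicComplexity

/-! ### Weight bookkeeping on `Option`-indexed exponents -/

variable {τ : Type*}

/-- `weight` is additive in the weight function. -/
theorem weight_add_fun (f g : Option τ → ℕ) (ν : Option τ →₀ ℕ) :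
    Finsupp.weight (f + g) ν = Finsupp.weight f ν + Finsupp.weight g ν := by
  simp only [Finsupp.weight_apply, Finsupp.sum, Pi.add_apply, smul_eq_mul, mul_add,
    Finset.sum_add_distrib]

/-- `weight` is monotone in the weight function. -/
theorem weight_mono_fun {f g : Option τ → ℕ} (h : ∀ o, f o ≤ g o) (ν : Option τ →₀ ℕ) :
    Finsupp.weight f ν ≤ Finsupp.weight g ν := by
  simp only [Finsupp.weight_apply, Finsupp.sum, smul_eq_mul]
  exact Finset.sum_le_sum fun o _ => Nat.mul_le_mul_left _ (h o)

/-- `weight (c • f) = c · weight f`. -/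
theorem weight_smul_fun (c : ℕ) (f : Option τ → ℕ) (ν : Option τ →₀ ℕ) :
    Finsupp.weight (fun o => c * f o) ν = c * Finsupp.weight f ν := by
  simp only [Finsupp.weight_apply, Finsupp.sum, smul_eq_mul, Finset.mul_sum]
  exact Finset.sum_congr rfl fun o _ => by ring

/-- The weight of the indicator of `none` is the exponent of `none`. -/
theorem weight_indicator_none [DecidableEq τ] (ν : Option τ →₀ ℕ) :
    Finsupp.weight (fun o : Option τ => if o = none then 1 else 0) ν = ν none := by
  classical
  simp only [Finsupp.weight_apply, Finsupp.sum, smul_eq_mul, mul_ite, mul_one, mul_zero]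
  rw [Finset.sum_ite_eq']
  split_ifs with h
  · rfl
  · rw [Finsupp.notMem_support_iff.1 h]

end Bridge

namespace Bridge

open Literature.Computability.AlgebraicComplexity

/-- **x₀₀-dominant extremal toric representations of `X₀₀^{m-3}·per₃` have size `≥ 7`.**
(`jetRegime_seven_le` transported to `F = g·det_m`.) [cite: AlperBogartVelasco2017, Theorem 1.2] -/
theorem seven_le_of_extremalToricRep_dominant (m : ℕ) [NeZero m] (h3m : 3 ≤ m)
    (g : Matrix (Fin m × Fin m) (Fin m × Fin m) ℂ) (w : Fin m × Fin m → ℕ) (e wmin : ℕ)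
    (hext : ∀ d ∈ (linSubst (Fin m × Fin m) ℂ g (detPoly (Fin m) ℂ)).support, Finsupp.weight w d ≤ e)
    (hpp : paddedPerPoly ℂ 3 m =
      weightedHomogeneousComponent w e (linSubst (Fin m × Fin m) ℂ g (detPoly (Fin m) ℂ)))
    (hmin : ∀ v : Fin m × Fin m, m - 3 ≤ (v.1 : ℕ) → m - 3 ≤ (v.2 : ℕ) → wmin ≤ w v)
    (h00 : wmin ≤ w (0, 0)) (hdom : e < (m - 2) * w (0, 0) + 2 * wmin) : 7 ≤ m := by
  classical
  set F : MvPolynomial (Fin m × Fin m) ℂ := linSubst (Fin m × Fin m) ℂ g (detPoly (Fin m) ℂ) with hF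
  have hFhom : F.IsHomogeneous m := by
    have h := linSubst_isHomogeneous g (detPoly_isHomogeneous (n := Fin m) (k := ℂ))
    rwa [Fintype.card_fin] at h
  -- block indices ≃ Fin 3
  obtain ⟨ε⟩ : Nonempty (BlockIdx 3 m ≃ Fin 3) := ⟨Fintype.equivFinOfCardEq (card_blockIdx h3m)⟩
  -- the two substitutions
  let aa' : Fin m × Fin m → MvPolynomial (Option (Fin 3 × Fin 3)) ℂ := fun v =>
    if h : m - 3 ≤ (v.1 : ℕ) ∧ m - 3 ≤ (v.2 : ℕ) then X (some (ε ⟨v.1, h.1⟩, ε ⟨v.2, h.2⟩))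
    else if v = (0, 0) then X none else 0
  let t₁ : Option (Fin 3 × Fin 3) → MvPolynomial (Fin 3 × Fin 3) ℂ := fun o => o.elim 1 X
  -- weights on the ten variables
  let γ : Fin 3 × Fin 3 → ℕ := fun p => w ((ε.symm p.1 : Fin m), (ε.symm p.2 : Fin m))
  let w'' : Option (Fin 3 × Fin 3) → ℕ := fun o => o.elim (w (0, 0)) γ
  let γ'' : Option (Fin 3 × Fin 3) → ℕ := fun o => o.elim 0 γ
  let β'' : Option (Fin 3 × Fin 3) → ℕ := fun o => o.elim 0 fun _ => 1
  -- compatibilities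
  have hblock00 : ¬ (m - 3 ≤ (((0, 0) : Fin m × Fin m).1 : ℕ) ∧ m - 3 ≤ (((0, 0) : Fin m × Fin m).2 : ℕ))
      ∨ m = 3 := by
    by_cases hm : m = 3
    · exact Or.inr hm
    · left; simp only [Fin.val_zero, Nat.le_zero]; omega
  have C1 : ∀ v, IsWeightedHomogeneous w'' (aa' v) (w v) := by
    intro v
    simp only [aa']
    split_ifs with h h0
    · have hw : w'' (some (ε ⟨v.1, h.1⟩, ε ⟨v.2, h.2⟩)) = w v := by
        simp [w'', γ]
      rw [← hw]
      exact isWeightedHomogeneous_X _ _ _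
    · subst h0
      exact isWeightedHomogeneous_X _ w'' none
    · exact isWeightedHomogeneous_zero _ _ _
  have C2 : ∀ v, IsWeightedHomogeneous (1 : Option (Fin 3 × Fin 3) → ℕ) (aa' v)
      ((1 : Fin m × Fin m → ℕ) v) := by
    intro v
    simp only [aa', Pi.one_apply]
    split_ifs
    · exact isWeightedHomogeneous_X _ _ _
    · exact isWeightedHomogeneous_X _ _ _
    · exact isWeightedHomogeneous_zero _ _ _
  have C3 : ∀ o, IsWeightedHomogeneous (1 : Fin 3 × Fin 3 → ℕ) (t₁ o) (β'' o) := by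
    intro o; cases o with
    | none => exact isWeightedHomogeneous_one _ _
    | some p => exact isWeightedHomogeneous_X _ _ _
  have C4 : ∀ o, IsWeightedHomogeneous γ (t₁ o) (γ'' o) := by
    intro o; cases o with
    | none => exact isWeightedHomogeneous_one _ _
    | some p =>
      show IsWeightedHomogeneous γ (X p) (γ p)
      exact isWeightedHomogeneous_X _ _ _
  -- `Q` and its structure
  set Q : MvPolynomial (Option (Fin 3 × Fin 3)) ℂ := aeval aa' F with hQ
  have hQhom : IsWeightedHomogeneous (1 : Option (Fin 3 × Fin 3) → ℕ) Q m :=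
    WeightedSubst.IsWeightedHomogeneous.aeval_of_forall 1 1 aa' C2 hFhom
  have hQwt : ∀ d ∈ Q.support, Finsupp.weight w'' d ≤ e :=
    WeightedSubst.weight_le_of_mem_support_aeval w w'' aa' C1 F e hext
  have hQtop : weightedHomogeneousComponent w'' e Q = aeval aa' (paddedPerPoly ℂ 3 m) := by
    rw [hQ, WeightedSubst.weightedHomogeneousComponent_aeval w w'' aa' C1, ← hpp]
  -- the weight identities on `Option`-exponents
  have hone : (1 : Option (Fin 3 × Fin 3) → ℕ) =
      (fun o => if o = none then 1 else 0) + β'' := by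
    funext o; cases o <;> simp [β'']
  have hw'' : w'' = (fun o => w (0, 0) * (if o = none then 1 else 0)) + γ'' := by
    funext o; cases o <;> simp [w'', γ'']
  have hdeg : ∀ ν ∈ Q.support, ν none + Finsupp.weight β'' ν = m := by
    intro ν hν
    have h := hQhom (MvPolynomial.mem_support_iff.1 hν)
    rwa [hone, weight_add_fun, weight_indicator_none] at h
  have hwt : ∀ ν : Option (Fin 3 × Fin 3) →₀ ℕ,
      Finsupp.weight w'' ν = w (0, 0) * ν none + Finsupp.weight γ'' ν := by
    intro ν
    rw [hw'', weight_add_fun, weight_smul_fun, weight_indicator_none]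
  have hγβ : ∀ ν : Option (Fin 3 × Fin 3) →₀ ℕ, wmin * Finsupp.weight β'' ν ≤ Finsupp.weight γ'' ν := by
    intro ν
    rw [← weight_smul_fun]
    refine weight_mono_fun (fun o => ?_) ν
    cases o with
    | none => simp [β'', γ'']
    | some p =>
      simp only [β'', γ'', Option.elim, mul_one, γ]
      exact hmin _ (ε.symm p.1).2 (ε.symm p.2).2
  -- block-degree ≤ 2 parts of `Q` vanish
  have hlow : ∀ d, d ≤ 2 → weightedHomogeneousComponent β'' d Q = 0 := by
    intro d hd
    refine weightedHomogeneousComponent_eq_zero' d Q fun ν hν hβ => ?_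
    have h1 := hdeg ν hν
    have h2 := hQwt ν hν
    have h3 := hwt ν
    have h4 := hγβ ν
    rw [hβ] at h1 h4
    -- `w'' ν ≥ w00 (m - d) + wmin d ≥ (m-2) w00 + 2 wmin > e`
    obtain ⟨k, hk⟩ : ∃ k, d + k = 2 := ⟨2 - d, by omega⟩
    have hνn : ν none = (m - 2) + k := by omega
    have hA : w (0, 0) * ν none = (m - 2) * w (0, 0) + w (0, 0) * k := by rw [hνn]; ring
    have hB : wmin * k ≤ w (0, 0) * k := Nat.mul_le_mul_right k h00
    have hC : 2 * wmin = wmin * d + wmin * k := by rw [← mul_add, hk, mul_comm]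
    omega
  -- `P = det A'` over the nine variables
  let Ψ : MvPolynomial (Fin m × Fin m) ℂ →ₐ[ℂ] MvPolynomial (Fin 3 × Fin 3) ℂ :=
    (aeval t₁).comp ((aeval aa').comp (linSubst (Fin m × Fin m) ℂ g))
  set A' : Matrix (Fin m) (Fin m) (MvPolynomial (Fin 3 × Fin 3) ℂ) :=
    (Matrix.mvPolynomialX (Fin m) (Fin m) ℂ).map Ψ with hA'
  set P : MvPolynomial (Fin 3 × Fin 3) ℂ := aeval t₁ Q with hP
  have hPdet : A'.det = P := by
    rw [hA', hP, hQ, hF, show (Matrix.mvPolynomialX (Fin m) (Fin m) ℂ).map ⇑Ψ =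
      (Ψ : MvPolynomial (Fin m × Fin m) ℂ →+* _).mapMatrix (Matrix.mvPolynomialX (Fin m) (Fin m) ℂ)
      from rfl, ← RingHom.map_det]
    rfl
  have hA'deg : ∀ i j, (A' i j).totalDegree ≤ 1 := by
    intro i j
    rw [hA', Matrix.map_apply, Matrix.mvPolynomialX_apply]
    show (aeval t₁ (aeval aa' (linSubst (Fin m × Fin m) ℂ g (X (i, j))))).totalDegree ≤ 1
    rw [linSubst_X, map_sum, map_sum]
    refine totalDegree_finsetSum_le fun u _ => ?_
    rw [map_smul, map_smul]
    refine (totalDegree_smul_le _ _).trans ?_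
    rw [aeval_X]
    simp only [aa']
    split_ifs
    · rw [aeval_X]; exact (totalDegree_X _).le
    · rw [aeval_X]; show (1 : MvPolynomial (Fin 3 × Fin 3) ℂ).totalDegree ≤ 1
      rw [totalDegree_one]; exact Nat.zero_le _
    · rw [map_zero, totalDegree_zero]; exact Nat.zero_le _
  -- homogeneous components of `P`
  have hcomp : ∀ d, homogeneousComponent d P = aeval t₁ (weightedHomogeneousComponent β'' d Q) := by
    intro d
    show weightedHomogeneousComponent 1 d P = _
    rw [hP, WeightedSubst.weightedHomogeneousComponent_aeval β'' 1 t₁ C3]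
  have hP0 : homogeneousComponent 0 A'.det = 0 := by rw [hPdet, hcomp, hlow 0 (by norm_num), map_zero]
  have hP1 : homogeneousComponent 1 A'.det = 0 := by rw [hPdet, hcomp, hlow 1 (by norm_num), map_zero]
  have hP2 : homogeneousComponent 2 A'.det = 0 := by rw [hPdet, hcomp, hlow 2 (by norm_num), map_zero]
  -- the cubic part and its top `γ`-weight component
  set Q₃ := weightedHomogeneousComponent β'' 3 Q with hQ₃
  have hQ₃supp : ∀ ν ∈ Q₃.support, ν ∈ Q.support ∧ Finsupp.weight β'' ν = 3 := by
    intro ν hν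
    rw [MvPolynomial.mem_support_iff, hQ₃, coeff_weightedHomogeneousComponent] at hν
    split_ifs at hν with h
    · exact ⟨mem_support_iff.2 hν, h⟩
    · exact absurd rfl hν
  set c : ℕ := (m - 3) * w (0, 0) with hc
  have hshift : ∀ ν ∈ Q₃.support, Finsupp.weight w'' ν = Finsupp.weight γ'' ν + c := by
    intro ν hν
    obtain ⟨hνQ, hβ⟩ := hQ₃supp ν hν
    have h1 := hdeg ν hνQ
    rw [hβ] at h1
    rw [hwt, hc, show ν none = m - 3 by omega]
    ring
  -- the specialised padded permanent
  have haa : ∀ v, (fun v => aeval t₁ (aa' v)) v =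
      if h : m - 3 ≤ (v.1 : ℕ) ∧ m - 3 ≤ (v.2 : ℕ) then X (ε ⟨v.1, h.1⟩, ε ⟨v.2, h.2⟩)
      else if v = (0, 0) then 1 else 0 := by
    intro v
    simp only [aa']
    split_ifs <;> simp [t₁]
  have hper : aeval t₁ (aeval aa' (paddedPerPoly ℂ 3 m)) = perPoly (Fin 3) ℂ := by
    rw [← AlgHom.comp_apply, comp_aeval]
    exact aeval_blockSpec_paddedPerPoly 3 m ε _ haa
  have hppQne : aeval aa' (paddedPerPoly ℂ 3 m) ≠ 0 := by
    intro h0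
    rw [h0, map_zero] at hper
    exact perPoly_ne_zero (Fin 3) ℂ hper.symm
  -- `β''`-homogeneity (weight 3) of the specialised padded permanent
  have hppβ : IsWeightedHomogeneous β'' (aeval aa' (paddedPerPoly ℂ 3 m)) 3 := by
    have hβaa : ∀ v, IsWeightedHomogeneous β'' (aa' v)
        ((fun v : Fin m × Fin m => if m - 3 ≤ (v.1 : ℕ) ∧ m - 3 ≤ (v.2 : ℕ) then 1 else 0) v) := by
      intro v
      simp only [aa']
      split_ifs
      · exact isWeightedHomogeneous_X _ _ _
      · exact isWeightedHomogeneous_X _ _ _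
      · exact isWeightedHomogeneous_zero _ _ _
    -- the padded permanent has block-degree `3`
    set blk : Fin m × Fin m → ℕ := fun v => if m - 3 ≤ (v.1 : ℕ) ∧ m - 3 ≤ (v.2 : ℕ) then 1 else 0
      with hblk
    have hx : IsWeightedHomogeneous blk ((X ((0 : Fin m), (0 : Fin m)) : MvPolynomial _ ℂ) ^ (m - 3)) 0 := by
      rcases Nat.eq_zero_or_pos (m - 3) with h0 | hpos
      · rw [h0, pow_zero]; exact isWeightedHomogeneous_one _ _
      · have h := (isWeightedHomogeneous_X ℂ blk ((0 : Fin m), (0 : Fin m))).pow (m - 3)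
        have hb : blk ((0 : Fin m), (0 : Fin m)) = 0 := by
          rw [hblk]; simp only [Fin.val_zero, Nat.le_zero]; rw [if_neg]; omega
        rwa [hb, smul_zero] at h
    have hr : IsWeightedHomogeneous blk
        (aeval (fun ij : BlockIdx 3 m × BlockIdx 3 m =>
          (X ((ij.1 : Fin m), (ij.2 : Fin m)) : MvPolynomial (Fin m × Fin m) ℂ))
          (perPoly (BlockIdx 3 m) ℂ)) 3 := by
      have hper3 : IsWeightedHomogeneous (1 : BlockIdx 3 m × BlockIdx 3 m → ℕ)
          (perPoly (BlockIdx 3 m) ℂ) 3 := by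
        have h := perPoly_isHomogeneous (n := BlockIdx 3 m) (k := ℂ)
        rwa [card_blockIdx h3m] at h
      refine WeightedSubst.IsWeightedHomogeneous.aeval_of_forall 1 blk _ (fun ij => ?_) hper3
      have h1 : blk ((ij.1 : Fin m), (ij.2 : Fin m)) = 1 := by
        rw [hblk]; simp only; rw [if_pos ⟨ij.1.2, ij.2.2⟩]
      simp only [Pi.one_apply]
      rw [← h1]
      exact isWeightedHomogeneous_X _ _ _
    have hpp3 : IsWeightedHomogeneous blk (paddedPerPoly ℂ 3 m) 3 := by
      have h := hx.mul hr
      rw [zero_add] at h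
      unfold paddedPerPoly
      rw [rename_eq_aeval]
      exact h
    exact WeightedSubst.IsWeightedHomogeneous.aeval_of_forall blk β'' aa' hβaa hpp3
  -- `c ≤ e`
  have hce : c ≤ e := by
    obtain ⟨ν, hν⟩ : ∃ ν, ν ∈ (aeval aa' (paddedPerPoly ℂ 3 m)).support := by
      by_contra h
      push Not at h
      exact hppQne (MvPolynomial.ext _ _ fun d => by
        by_cases hd : d ∈ (aeval aa' (paddedPerPoly ℂ 3 m)).support
        · exact absurd hd (h d)
        · rw [MvPolynomial.notMem_support_iff.1 hd, coeff_zero])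
    have hνe : Finsupp.weight w'' ν = e := by
      rw [← hQtop] at hν
      exact (weightedHomogeneousComponent_isWeightedHomogeneous (w := w'') e Q) (MvPolynomial.mem_support_iff.1 hν)
    have hν3 : Finsupp.weight β'' ν = 3 := hppβ (MvPolynomial.mem_support_iff.1 hν)
    have hνQ : ν ∈ Q.support := by
      rw [← hQtop] at hν
      have hcf := MvPolynomial.mem_support_iff.1 hν
      rw [coeff_weightedHomogeneousComponent] at hcf
      by_cases hw : Finsupp.weight w'' ν = e
      · rw [if_pos hw] at hcf; exact MvPolynomial.mem_support_iff.2 hcf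
      · rw [if_neg hw] at hcf; exact absurd rfl hcf
    have h1 := hdeg ν hνQ
    rw [hν3] at h1
    rw [← hνe, hwt, hc, show ν none = m - 3 by omega]
    nlinarith
  -- top component and weight bound of `P₃`
  have htop : weightedHomogeneousComponent γ (e - c) (homogeneousComponent 3 A'.det) =
      perPoly (Fin 3) ℂ := by
    rw [hPdet, hcomp, ← hQ₃, WeightedSubst.weightedHomogeneousComponent_aeval γ'' γ t₁ C4,
      WeightedSubst.weightedHomogeneousComponent_eq_of_shift γ'' w'' c Q₃ hshift (e - c),
      Nat.sub_add_cancel hce, hQ₃, WeightedSubst.weightedHomogeneousComponent_comm, hQtop,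
      hppβ.weightedHomogeneousComponent_same, hper]
  have hwe : ∀ d ∈ (homogeneousComponent 3 A'.det).support, Finsupp.weight γ d ≤ e - c := by
    rw [hPdet, hcomp, ← hQ₃]
    refine WeightedSubst.weight_le_of_mem_support_aeval γ'' γ t₁ C4 Q₃ (e - c) fun ν hν => ?_
    have h1 := hshift ν hν
    have h2 := hQwt ν (hQ₃supp ν hν).1
    omega
  exact JetRegime.seven_le_of_jetRegime A' hA'deg hP0 hP1 hP2 γ (e - c) hwe htop

end Bridge

/-- **x₀₀-dominant extremal toric representations of `X₀₀^{m-3}·per₃` have size `≥ 7`**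
(registered helper form of `Bridge.seven_le_of_extremalToricRep_dominant`).
[cite: AlperBogartVelasco2017, Theorem 1.2] -/
theorem extremalToricRep_dominant_seven_le : ∀ (m : ℕ) [NeZero m], 3 ≤ m → ∀ (g : Matrix (Fin m × Fin m) (Fin m × Fin m) ℂ) (w : Fin m × Fin m → ℕ) (e wmin : ℕ), (∀ d ∈ (Literature.Computability.AlgebraicComplexity.linSubst (Fin m × Fin m) ℂ g (Literature.Computability.AlgebraicComplexity.detPoly (Fin m) ℂ)).support, Finsupp.weight w d ≤ e) → Literature.Computability.AlgebraicComplexity.paddedPerPoly ℂ 3 m = MvPolynomial.weightedHomogeneousComponent w e (Literature.Computability.AlgebraicComplexity.linSubst (Fin m × Fin m) ℂ g (Literature.Computability.AlgebraicComplexity.detPoly (Fin m) ℂ)) → (∀ v : Fin m × Fin m, m - 3 ≤ (v.1 : ℕ) → m - 3 ≤ (v.2 : ℕ) → wmin ≤ w v) → wmin ≤ w (0, 0) → e < (m - 2) * w (0, 0) + 2 * wmin → 7 ≤ m :=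
  fun m _ h3m g w e wmin hext hpp hmin h00 hdom =>
    Bridge.seven_le_of_extremalToricRep_dominant m h3m g w e wmin hext hpp hmin h00 hdom

end

end Summit.ValiantsHypothesis.ValiantsHypothesis.Theorems.BorderApolarityToricWitnessObstructionQP
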